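import Summits.HubbardSuperconductivity.HubbardSuperconductivity.Theorems.WidthHaldaneTubePlaneWaves

/-!
# The seam of the twisted tube at `U = 0`: quasi-periodic phases and the twist as a one-body matrix

First half of the diagonalisation of the free TWISTED tube (second half:
`WidthHaldaneTubeTwistedPlaneWaves.lean`). For the flux `θ` through the long cycle of `ℤ/L × ℤ/M` (seam
phases `-e^{±iθ}` between the columns `-1` and `0`, `tubeTwist`):

* `twistPhase_succ_of_ne`, `twistPhase_neg_one`, `seam_hop_succ`, `seam_hop_pred` — the phase
  `p ↦ e^{i(2πa-θ)p/L}` on representatives `p = 0, …, L-1` absorbs the seam: hopping forward across it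
  costs `e^{-iθ}`, backward `e^{+iθ}` (`val` bookkeeping of `WidthHaldaneTubeGauge`);
* `tubeTwist_eq_dGamma` — the twist is `dΓ` of the seam one-body correction `T_θ`, so that
  `tubeH0 … 0 + tubeTwist … θ = dΓ(h + T_θ)` is a free Hamiltonian (`tubeH0_zero_eq_dGamma`, `dGamma_add`).

Sources: N. Byers, C. N. Yang, PRL 7 (1961) 46; D. J. Scalapino, S. R. White, S. C. Zhang, PRB 47
(1993) 7995 §II. Folklore; no definitions, no named facts.
-/

noncomputable section

namespace Summit.HubbardSuperconductivity.HubbardSuperconductivity.Theorems.WidthHaldane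

set_option linter.dupNamespace false -- summit = problem name (single-conjunct summit), D-0017

open scoped BigOperators Classical Matrix ComplexConjugate
open Matrix Finset Literature.MathematicalPhysics.QuantumLattice

/-! ### The twisted phase along the long cycle and its two seam hops -/

section TwistPhase

variable {L : ℕ} [NeZero L]

omit [NeZero L] in
/-- `exp(2πi a.val) = 1`. [folklore] -/
theorem exp_two_pi_mul_val_mul_I (a : ZMod L) :
    Complex.exp (2 * Real.pi * (a.val : ℂ) * Complex.I) = 1 := by
  have := Complex.exp_nat_mul_two_pi_mul_I a.val
  rw [← this]
  congr 1
  ring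

omit [NeZero L] in
/-- The long-cycle factor of the twisted wave, `φ_a(p) = e^{i(2πa - θ) p/L}` on representatives, one step
inside the columns: `φ_a(p+1) = e^{i(2πa-θ)/L} φ_a(p)` for `p ≠ -1`. [folklore] -/
theorem twistPhase_succ_of_ne (hL : 3 ≤ L) (θ : ℝ) (a : ZMod L) {p : ZMod L} (hp : p ≠ -1) :
    Complex.exp (Complex.I * (((2 * Real.pi * (a.val : ℝ) - θ) * ((p + 1).val : ℝ) / L : ℝ) : ℂ)) =
      Complex.exp (Complex.I * (((2 * Real.pi * (a.val : ℝ) - θ) / L : ℝ) : ℂ)) *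
        Complex.exp (Complex.I * (((2 * Real.pi * (a.val : ℝ) - θ) * (p.val : ℝ) / L : ℝ) : ℂ)) := by
  rw [val_cast_add_one L hL hp, ← Complex.exp_add]
  congr 1
  push_cast
  ring

/-- The twisted phase at the last column `p = -1` (representative `L - 1`):
`e^{i(2πa-θ)(L-1)/L} = e^{-iθ} e^{-i(2πa-θ)/L}`. [folklore] -/
theorem twistPhase_neg_one (θ : ℝ) (a : ZMod L) :
    Complex.exp (Complex.I * (((2 * Real.pi * (a.val : ℝ) - θ) * (((-1 : ZMod L)).val : ℝ) / L : ℝ) : ℂ)) =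
      Complex.exp (-(Complex.I * θ)) *
        Complex.exp (-(Complex.I * (((2 * Real.pi * (a.val : ℝ) - θ) / L : ℝ) : ℂ))) := by
  have hL0 : (L : ℂ) ≠ 0 := Nat.cast_ne_zero.2 (NeZero.ne L)
  rw [val_cast_of_eq_neg_one L rfl, ← Complex.exp_add]
  have h1 := exp_two_pi_mul_val_mul_I a
  rw [← mul_one (Complex.exp (-(Complex.I * θ) + _)), ← h1, ← Complex.exp_add]
  congr 1
  push_cast
  field_simp
  ring

omit [NeZero L] in
/-- The twisted phase at the representative `0` is `1`. [folklore] -/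
theorem twistPhase_zero (θ : ℝ) (a : ZMod L) :
    Complex.exp (Complex.I * (((2 * Real.pi * (a.val : ℝ) - θ) * (((0 : ZMod L)).val : ℝ) / L : ℝ) : ℂ)) = 1 := by
  rw [ZMod.val_zero, Nat.cast_zero, mul_zero, zero_div, Complex.ofReal_zero, mul_zero, Complex.exp_zero]

/-- **Forward hop, seam included.** `[p = -1] e^{-iθ} · φ_a(p+1) = e^{i(2πa-θ)/L} φ_a(p)` (with `[·]`
read as `1` off the seam): the seam phase `e^{-iθ}` of `c†_{(-1,b)} c_{(0,b)}` repairs the wrap of the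
representative. [folklore] -/
theorem seam_hop_succ (hL : 3 ≤ L) (θ : ℝ) (a p : ZMod L) :
    (if p = -1 then Complex.exp (-(Complex.I * θ)) else 1) *
        Complex.exp (Complex.I * (((2 * Real.pi * (a.val : ℝ) - θ) * ((p + 1).val : ℝ) / L : ℝ) : ℂ)) =
      Complex.exp (Complex.I * (((2 * Real.pi * (a.val : ℝ) - θ) / L : ℝ) : ℂ)) *
        Complex.exp (Complex.I * (((2 * Real.pi * (a.val : ℝ) - θ) * (p.val : ℝ) / L : ℝ) : ℂ)) := by
  by_cases hp : p = -1
  · subst hp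
    rw [if_pos rfl, neg_add_cancel, twistPhase_zero, mul_one, twistPhase_neg_one, ← mul_assoc,
      ← Complex.exp_add, ← Complex.exp_add]
    congr 1
    ring
  · rw [if_neg hp, one_mul, twistPhase_succ_of_ne hL θ a hp]

/-- **Backward hop, seam included.** `[p = 0] e^{iθ} · φ_a(p-1) = e^{-i(2πa-θ)/L} φ_a(p)`. [folklore] -/
theorem seam_hop_pred (hL : 3 ≤ L) (θ : ℝ) (a p : ZMod L) :
    (if p = 0 then Complex.exp (Complex.I * θ) else 1) *
        Complex.exp (Complex.I * (((2 * Real.pi * (a.val : ℝ) - θ) * ((p - 1).val : ℝ) / L : ℝ) : ℂ)) =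
      Complex.exp (-(Complex.I * (((2 * Real.pi * (a.val : ℝ) - θ) / L : ℝ) : ℂ))) *
        Complex.exp (Complex.I * (((2 * Real.pi * (a.val : ℝ) - θ) * (p.val : ℝ) / L : ℝ) : ℂ)) := by
  by_cases hp : p = 0
  · subst hp
    rw [if_pos rfl, zero_sub, twistPhase_neg_one, twistPhase_zero, mul_one, ← mul_assoc, ← Complex.exp_add,
      ← Complex.exp_add]
    congr 1
    ring
  · have hp' : p - 1 ≠ -1 := fun h => hp (by linear_combination h)
    have h := twistPhase_succ_of_ne hL θ a hp'
    rw [sub_add_cancel] at h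
    rw [if_neg hp, one_mul, h, ← mul_assoc, ← Complex.exp_add, neg_add_cancel, Complex.exp_zero, one_mul]

end TwistPhase


/-! ### The twisted tube is `dΓ` of the hopping matrix with seam phases -/

section TwistedOneBody

variable {L M : ℕ} [NeZero L] [NeZero M] {Λ : Type} [LinearOrder Λ] [Fintype Λ]
  (e : Λ ≃ ZMod L × ZMod M)

/-- **The seam twist is quadratic**: `tubeTwist L M Λ e θ = dΓ(T_θ)` with the seam one-body correction
`T_θ = Σ_b (1 - e^{iθ}) |(0,b)⟩⟨(-1,b)| + (1 - e^{-iθ}) |(-1,b)⟩⟨(0,b)|` (per spin), spelled out as a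
`Matrix.of` over the carrier. Scalapino–White–Zhang (1993) §II. [folklore] -/
theorem tubeTwist_eq_dGamma (θ : ℝ) :
    tubeTwist L M Λ e θ = dGamma (Matrix.of fun o o' : Orb Λ =>
      if (ofLex o).2 = (ofLex o').2 then
        ((if (e (ofLex o).1).1 = 0 ∧ (ofLex o').1 = e.symm (-1, (e (ofLex o).1).2) then
            (1 - Complex.exp (Complex.I * θ)) else 0) +
          (if (e (ofLex o').1).1 = 0 ∧ (ofLex o).1 = e.symm (-1, (e (ofLex o').1).2) then
            (1 - Complex.exp (-(Complex.I * θ))) else 0))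
      else 0) := by
  set T : Matrix (Orb Λ) (Orb Λ) ℂ := Matrix.of fun o o' : Orb Λ =>
      if (ofLex o).2 = (ofLex o').2 then
        ((if (e (ofLex o).1).1 = 0 ∧ (ofLex o').1 = e.symm (-1, (e (ofLex o).1).2) then
            (1 - Complex.exp (Complex.I * θ)) else 0) +
          (if (e (ofLex o').1).1 = 0 ∧ (ofLex o).1 = e.symm (-1, (e (ofLex o').1).2) then
            (1 - Complex.exp (-(Complex.I * θ))) else 0))
      else 0 with hT
  have T_apply : ∀ (x : Λ) (σ : Fin 2) (y : Λ) (τ : Fin 2), T (orb x σ) (orb y τ) =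
      if σ = τ then
        ((if (e x).1 = 0 ∧ y = e.symm (-1, (e x).2) then (1 - Complex.exp (Complex.I * θ)) else 0) +
          (if (e y).1 = 0 ∧ x = e.symm (-1, (e y).2) then (1 - Complex.exp (-(Complex.I * θ))) else 0))
      else 0 := fun _ _ _ _ => rfl
  -- expand `dΓ(T)` over sites and spins
  have hexp : dGamma T = ∑ x : Λ, ∑ σ : Fin 2, ∑ y : Λ,
      (((if (e x).1 = 0 ∧ y = e.symm (-1, (e x).2) then (1 - Complex.exp (Complex.I * θ)) else 0) +
          (if (e y).1 = 0 ∧ x = e.symm (-1, (e y).2) then (1 - Complex.exp (-(Complex.I * θ))) else 0)) •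
        (creation (orb x σ) * annihilation (orb y σ))) := by
    rw [dGamma, sum_orb_eq_sum_sum]
    refine Finset.sum_congr rfl fun x _ => Finset.sum_congr rfl fun σ _ => ?_
    rw [sum_orb_eq_sum_sum]
    refine Finset.sum_congr rfl fun y _ => ?_
    rw [Finset.sum_eq_single σ]
    · rw [T_apply, if_pos rfl]
    · intro τ _ hτ; rw [T_apply, if_neg (Ne.symm hτ), zero_smul]
    · intro h; exact absurd (mem_univ _) h
  rw [hexp]
  simp_rw [add_smul, Finset.sum_add_distrib, ite_smul, zero_smul]
  rw [tubeTwist, Finset.sum_comm]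
  simp_rw [Finset.sum_add_distrib]
  congr 1
  · conv_rhs => rw [Finset.sum_comm]
    refine Finset.sum_congr rfl fun σ _ => ?_
    exact sum_seam_eq_sum_sum L M Λ e (fun x y => (1 - Complex.exp (Complex.I * θ)) •
      (creation (orb x σ) * annihilation (orb y σ)))
  · conv_rhs => rw [Finset.sum_comm]
    refine Finset.sum_congr rfl fun σ _ => ?_
    exact sum_seam_eq_sum_sum' L M Λ e (fun x y => (1 - Complex.exp (-(Complex.I * θ))) •
      (creation (orb x σ) * annihilation (orb y σ)))

end TwistedOneBody


end Summit.HubbardSuperconductivity.HubbardSuperconductivity.Theorems.WidthHaldane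

end
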